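import Summits.ValiantsHypothesis.ValiantsHypothesis.Theorems.NewtonUnitEquationsTwoProductsTowerRecordDefs

/-!
# R13∞-coeff — THE ENVELOPE WALK (abstract): optimal sets along a pencil of slopes (val-idea-37 g4 rev 5 §12, part 2/3)

(8b) For any finite `T`, scores `α + θσ` and potential `Ψ : T → ℕ`: `OptA`/`RVA` (right vertex)/`PhiA = max Ψ`, `sigma_le_of_opt`, ★ `envelope` /
`envelope_lt` (if (F3) `Ψ` rises strictly towards the right vertex inside every optimal set, then between right vertices at `θ₁ < θ₂` that differ as points
`Ψ` rises strictly — strong induction on the crossing set through the next breakpoint), `RVA_eq_of_ptEq`, `PhiA_lt`, ★ `RVA_eq_of_PhiA_eq` (the right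
vertex FACTORS THROUGH `Φ`), `exists_lineFamily` (`≤ B+1` values of any function of the right vertex along a line).  Pure combinatorics of upper envelopes;
no pencil data.
Transplant (val-lit-p3 g18) of val-idea-37 g4's kernel-checked scratch `Cruxes/TwoProducts/TowerRecords_val_idea_37_g4.lean` (rev 5 §12,
sha16 bf5159e121ff5e9d (§1–§11 = rev 4 2a92eb1f7d59f466); val-idea-crit-8 g2 VERDICT #20 by-name check, ns `ValIdea37g4T`; val-idea-crit-8 g2 VERDICT #19 + addendum: KEEP «R13-coeff», by-name GO for a verbatim transplant);
proofs verbatim by name, docstrings added, namespace = the tree's.  Helper on crux `stmt-ValiantsHypothesis-5906` (`TwoProducts`, line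
`relation_ladder`); `--supports`, closes nothing by itself.  HONEST LABEL (crit-8 #19): COEFFICIENT-SIDE; the class rung it feeds (R13, dense
parallel towers on dissociated carriers) is a wider CLASS rung, inert as a hatch; F10's collinear digit towers NOT covered; `ResidualLawV24` ⟺
`PlanarCellBound`, the crux (stmt-5906), every `closes` binder and every summit statement UNMOVED; VP ≠ VNP is NOT proved.
Credit: mathematics and kernel proofs val-idea-37 g4; critic of record val-idea-crit-8 g2.  No instances, no notation, no named facts. [folklore]
-/

set_option linter.dupNamespace false

noncomputable section

open Classical

namespace Summit.ValiantsHypothesis.ValiantsHypothesis.Theorems.NewtonUnitEquations.TwoProducts.TowerRecord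

open scoped BigOperators
open Module Polynomial
open Summit.ValiantsHypothesis.ValiantsHypothesis.Theorems.NewtonUnitEquations.TwoProducts.FormalLogLinearisation
open Summit.ValiantsHypothesis.ValiantsHypothesis.Theorems.NewtonUnitEquations.TwoProducts.MomentRecord
open Summit.ValiantsHypothesis.ValiantsHypothesis.Theorems.NewtonUnitEquations.TwoProducts.PlanarCell

variable {m n : ℕ}

/-! ### The envelope walk (abstract): optimal sets along a pencil of slopes -/

section Envelope

variable {ι : Type*}

/-- Optimal set at slope `θ`: maximisers of `α + θ σ` over `T`. -/
def OptA (T : Finset ι) (α σ : ι → ℝ) (θ : ℝ) : Finset ι :=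
  T.filter fun p => ∀ q ∈ T, α q + θ * σ q ≤ α p + θ * σ p

/-- Right vertex at slope `θ`: the `σ`-maximal optimal elements. -/
def RVA (T : Finset ι) (α σ : ι → ℝ) (θ : ℝ) : Finset ι :=
  (OptA T α σ θ).filter fun p => ∀ q ∈ OptA T α σ θ, σ q ≤ σ p

/-- Envelope potential: the largest `Ψ` on the right vertex. -/
def PhiA (T : Finset ι) (α σ : ι → ℝ) (Ψv : ι → ℕ) (θ : ℝ) : ℕ := (RVA T α σ θ).sup Ψv

variable {T : Finset ι} {α σ : ι → ℝ}

/-- Membership in the optimal set. [folklore] -/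
theorem mem_OptA {θ : ℝ} {p : ι} : p ∈ OptA T α σ θ ↔ p ∈ T ∧ ∀ q ∈ T, α q + θ * σ q ≤ α p + θ * σ p :=
  Finset.mem_filter

/-- Membership in the right vertex. [folklore] -/
theorem mem_RVA {θ : ℝ} {p : ι} : p ∈ RVA T α σ θ ↔ p ∈ OptA T α σ θ ∧ ∀ q ∈ OptA T α σ θ, σ q ≤ σ p :=
  Finset.mem_filter

/-- The optimal set of a nonempty `T` is nonempty. [folklore] -/
theorem OptA_nonempty (hT : T.Nonempty) (θ : ℝ) : (OptA T α σ θ).Nonempty := by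
  obtain ⟨p, hp, hmax⟩ := Finset.exists_max_image T (fun q => α q + θ * σ q) hT
  exact ⟨p, mem_OptA.mpr ⟨hp, hmax⟩⟩

/-- The right vertex of a nonempty `T` is nonempty. [folklore] -/
theorem RVA_nonempty (hT : T.Nonempty) (θ : ℝ) : (RVA T α σ θ).Nonempty := by
  obtain ⟨q, hq, hqmax⟩ := Finset.exists_max_image _ σ (OptA_nonempty (α := α) (σ := σ) hT θ)
  exact ⟨q, mem_RVA.mpr ⟨hq, hqmax⟩⟩

/-- Slopes of optimal elements are monotone in `θ`. [folklore] -/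
theorem sigma_le_of_opt {θ₁ θ₂ : ℝ} (h : θ₁ < θ₂) {p q : ι} (hp : p ∈ OptA T α σ θ₁) (hq : q ∈ OptA T α σ θ₂) :
    σ p ≤ σ q := by
  have h1 := (mem_OptA.mp hp).2 q (mem_OptA.mp hq).1
  have h2 := (mem_OptA.mp hq).2 p (mem_OptA.mp hp).1
  by_contra hlt
  rw [not_le] at hlt
  nlinarith [mul_pos (sub_pos.mpr h) (sub_pos.mpr hlt)]

/-- Optimal elements at two slopes with equal `σ` have equal `α`. [folklore] -/
theorem alpha_eq_of_opt {θ₁ θ₂ : ℝ} {p q : ι} (hp : p ∈ OptA T α σ θ₁) (hq : q ∈ OptA T α σ θ₂) (hσ : σ p = σ q) :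
    α p = α q := by
  have h1 := (mem_OptA.mp hp).2 q (mem_OptA.mp hq).1
  have h2 := (mem_OptA.mp hq).2 p (mem_OptA.mp hp).1
  rw [hσ] at h1 h2
  linarith

/-- THE ENVELOPE LEMMA: if inside every optimal set `Ψ` rises strictly towards the right vertex (F3), then `Ψ` rises strictly from any
optimal element at slope `θ₁` to the right vertex at any slope `θ₂ ≥ θ₁` with larger `σ` (strong induction on the crossing set). -/
theorem envelope (Ψv : ι → ℕ)
    (F3 : ∀ θ : ℝ, ∀ p ∈ OptA T α σ θ, ∀ q ∈ RVA T α σ θ, σ p < σ q → Ψv p < Ψv q) :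
    ∀ (M : ℕ) {θ₁ θ₂ : ℝ} {p q : ι}, θ₁ ≤ θ₂ → p ∈ OptA T α σ θ₁ → q ∈ RVA T α σ θ₂ → σ p < σ q →
      (T.filter fun o => σ p < σ o).card = M → Ψv p < Ψv q := by
  intro M
  induction M using Nat.strong_induction_on with
  | _ M ih =>
    intro θ₁ θ₂ p q h12 hp hq hσ hM
    obtain ⟨hpT, hpopt⟩ := mem_OptA.mp hp
    have hqO : q ∈ OptA T α σ θ₂ := (mem_RVA.mp hq).1
    have hqT : q ∈ T := (mem_OptA.mp hqO).1
    -- the crossing set and the next breakpoint `μ`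
    have hmemC : ∀ {o : ι}, o ∈ T.filter (fun o => σ p < σ o) ↔ o ∈ T ∧ σ p < σ o := fun {o} => Finset.mem_filter
    have hqC : q ∈ T.filter (fun o => σ p < σ o) := hmemC.mpr ⟨hqT, hσ⟩
    have hCne : (T.filter fun o => σ p < σ o).Nonempty := ⟨q, hqC⟩
    have hκne : ((T.filter fun o => σ p < σ o).image fun o => (α p - α o) / (σ o - σ p)).Nonempty := hCne.image _
    obtain ⟨μ, hμdef⟩ : ∃ μ : ℝ, μ = ((T.filter fun o => σ p < σ o).image fun o => (α p - α o) / (σ o - σ p)).min' hκne :=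
      ⟨_, rfl⟩
    have hμle : ∀ o ∈ T.filter (fun o => σ p < σ o), μ ≤ (α p - α o) / (σ o - σ p) := fun o ho =>
      hμdef ▸ Finset.min'_le _ _ (Finset.mem_image_of_mem (fun o => (α p - α o) / (σ o - σ p)) ho)
    have h1μ : θ₁ ≤ μ := by
      rw [hμdef]
      refine Finset.le_min' _ _ _ fun y hy => ?_
      obtain ⟨o, ho, rfl⟩ := Finset.mem_image.mp hy
      obtain ⟨hoT, hσo⟩ := hmemC.mp ho
      have := hpopt o hoT
      rw [le_div_iff₀ (sub_pos.mpr hσo), mul_sub]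
      linarith
    obtain ⟨θs, hθsdef⟩ : ∃ θs : ℝ, θs = min θ₂ μ := ⟨_, rfl⟩
    have h1s : θ₁ ≤ θs := hθsdef ▸ le_min h12 h1μ
    have hs2 : θs ≤ θ₂ := hθsdef ▸ min_le_left _ _
    have hsμ : θs ≤ μ := hθsdef ▸ min_le_right _ _
    -- `p` stays optimal up to `θs`
    have hpOs : p ∈ OptA T α σ θs := by
      refine mem_OptA.mpr ⟨hpT, fun o hoT => ?_⟩
      have hpo := hpopt o hoT
      by_cases hσo : σ p < σ o
      · have hk : θs ≤ (α p - α o) / (σ o - σ p) := hsμ.trans (hμle o (hmemC.mpr ⟨hoT, hσo⟩))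
        rw [le_div_iff₀ (sub_pos.mpr hσo), mul_sub] at hk
        linarith
      · rw [not_lt] at hσo
        have : (θs - θ₁) * σ o ≤ (θs - θ₁) * σ p := mul_le_mul_of_nonneg_left hσo (sub_nonneg.mpr h1s)
        rw [sub_mul, sub_mul] at this
        linarith
    -- the right vertex at `θs`
    obtain ⟨qs, hqs⟩ := RVA_nonempty (α := α) (σ := σ) ⟨p, hpT⟩ θs
    obtain ⟨hqsO, hqsmax⟩ := mem_RVA.mp hqs
    have hqsT : qs ∈ T := (mem_OptA.mp hqsO).1
    rcases eq_or_lt_of_le hs2 with hEq | hLt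
    · rw [hEq] at hpOs
      exact F3 θ₂ p hpOs q hq hσ
    · -- `θs = μ < θ₂`: a crossing element is optimal at `θs`, so the right vertex has larger `σ`
      have hμ2 : μ < θ₂ := by
        by_contra hh
        rw [not_lt] at hh
        rw [hθsdef, min_eq_left hh] at hLt
        exact lt_irrefl _ hLt
      have hsEq : θs = μ := by rw [hθsdef, min_eq_right hμ2.le]
      obtain ⟨o₀, ho₀C, hκo₀⟩ := Finset.mem_image.mp (hμdef ▸ Finset.min'_mem _ hκne)
      obtain ⟨ho₀T, hσo₀⟩ := hmemC.mp ho₀C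
      have hrel : α p - α o₀ = μ * (σ o₀ - σ p) := (div_eq_iff (ne_of_gt (sub_pos.mpr hσo₀))).mp hκo₀
      have ho₀O : o₀ ∈ OptA T α σ θs := by
        refine mem_OptA.mpr ⟨ho₀T, fun o' ho' => ?_⟩
        have := (mem_OptA.mp hpOs).2 o' ho'
        rw [hsEq] at this ⊢
        rw [mul_sub] at hrel
        linarith
      have hσqs : σ p < σ qs := lt_of_lt_of_le hσo₀ (hqsmax o₀ ho₀O)
      have hΨ1 : Ψv p < Ψv qs := F3 θs p hpOs qs hqs hσqs
      rcases lt_or_eq_of_le (sigma_le_of_opt hLt hqsO hqO) with hlt2 | heq2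
      · have hcard : (T.filter fun o => σ qs < σ o).card < M := by
          rw [← hM]
          refine Finset.card_lt_card (Finset.ssubset_iff_subset_ne.mpr ⟨fun o ho => ?_, fun hEq' => ?_⟩)
          · obtain ⟨hoT, hlo⟩ := Finset.mem_filter.mp ho
            exact Finset.mem_filter.mpr ⟨hoT, hσqs.trans hlo⟩
          · have : qs ∈ T.filter fun o => σ qs < σ o := by
              rw [hEq']
              exact Finset.mem_filter.mpr ⟨hqsT, hσqs⟩
            exact lt_irrefl _ (Finset.mem_filter.mp this).2
        exact hΨ1.trans (ih _ hcard hs2 hqsO hq hlt2 rfl)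
      · have hαq : α qs = α q := alpha_eq_of_opt hqsO hqO heq2
        have hqOs : q ∈ OptA T α σ θs := by
          refine mem_OptA.mpr ⟨hqT, fun o' ho' => ?_⟩
          have := (mem_OptA.mp hqsO).2 o' ho'
          rw [hαq, heq2] at this
          exact this
        have hqRs : q ∈ RVA T α σ θs := mem_RVA.mpr ⟨hqOs, fun o' ho' => heq2 ▸ hqsmax o' ho'⟩
        exact F3 θs p hpOs q hqRs hσ

/-- The envelope walk, strict form: `Ψ` rises strictly between distinct right-vertex points. [folklore] -/
theorem envelope_lt (Ψv : ι → ℕ)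
    (F3 : ∀ θ : ℝ, ∀ p ∈ OptA T α σ θ, ∀ q ∈ RVA T α σ θ, σ p < σ q → Ψv p < Ψv q)
    {θ₁ θ₂ : ℝ} (h : θ₁ < θ₂) {p q : ι} (hp : p ∈ RVA T α σ θ₁) (hq : q ∈ RVA T α σ θ₂)
    (hne : ¬ (α p = α q ∧ σ p = σ q)) : Ψv p < Ψv q := by
  have hpO := (mem_RVA.mp hp).1
  have hqO := (mem_RVA.mp hq).1
  rcases lt_or_eq_of_le (sigma_le_of_opt h hpO hqO) with hlt | heq
  · exact envelope Ψv F3 _ h.le hpO hq hlt rfl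
  · exact absurd ⟨alpha_eq_of_opt hpO hqO heq, heq⟩ hne

/-- A right vertex is a point class: it is determined by the `(α, σ)`-value of any member. -/
theorem RVA_eq_of_ptEq {θ₁ θ₂ : ℝ} {p q : ι} (hp : p ∈ RVA T α σ θ₁) (hq : q ∈ RVA T α σ θ₂)
    (h : α p = α q ∧ σ p = σ q) : RVA T α σ θ₁ = RVA T α σ θ₂ := by
  suffices key : ∀ {θ θ' : ℝ} {p q : ι}, p ∈ RVA T α σ θ → q ∈ RVA T α σ θ' → (α p = α q ∧ σ p = σ q) →
      RVA T α σ θ ⊆ RVA T α σ θ' from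
    Finset.Subset.antisymm (key hp hq h) (key hq hp ⟨h.1.symm, h.2.symm⟩)
  intro θ θ' p q hp hq h o ho
  obtain ⟨hpO, hpmax⟩ := mem_RVA.mp hp
  obtain ⟨hqO, hqmax⟩ := mem_RVA.mp hq
  obtain ⟨hoO, homax⟩ := mem_RVA.mp ho
  have hσo : σ o = σ p := le_antisymm (hpmax o hoO) (homax p hpO)
  have hαo : α o = α p := alpha_eq_of_opt hoO hpO hσo
  have hoT : o ∈ T := (mem_OptA.mp hoO).1
  have hoO' : o ∈ OptA T α σ θ' := by
    refine mem_OptA.mpr ⟨hoT, fun o' ho' => ?_⟩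
    have := (mem_OptA.mp hqO).2 o' ho'
    rw [hαo, hσo, h.1, h.2]
    exact this
  exact mem_RVA.mpr ⟨hoO', fun o' ho' => by rw [hσo, h.2]; exact hqmax o' ho'⟩

/-- `Φ = max Ψ` over the right vertex rises strictly between distinct right-vertex points. [folklore] -/
theorem PhiA_lt (Ψv : ι → ℕ)
    (F3 : ∀ θ : ℝ, ∀ p ∈ OptA T α σ θ, ∀ q ∈ RVA T α σ θ, σ p < σ q → Ψv p < Ψv q)
    (hT : T.Nonempty) {θ₁ θ₂ : ℝ} (h : θ₁ < θ₂)
    (hne : ∀ p ∈ RVA T α σ θ₁, ∀ q ∈ RVA T α σ θ₂, ¬ (α p = α q ∧ σ p = σ q)) :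
    PhiA T α σ Ψv θ₁ < PhiA T α σ Ψv θ₂ := by
  obtain ⟨p₀, hp₀, hsup⟩ := Finset.exists_mem_eq_sup _ (RVA_nonempty (α := α) (σ := σ) hT θ₁) Ψv
  obtain ⟨q₀, hq₀⟩ := RVA_nonempty (α := α) (σ := σ) hT θ₂
  unfold PhiA
  rw [hsup]
  exact lt_of_lt_of_le (envelope_lt Ψv F3 h hp₀ hq₀ (hne p₀ hp₀ q₀ hq₀)) (Finset.le_sup hq₀)

/-- `N` FACTORS THROUGH `Φ`: equal envelope potential ⇒ the same right vertex. -/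
theorem RVA_eq_of_PhiA_eq (Ψv : ι → ℕ)
    (F3 : ∀ θ : ℝ, ∀ p ∈ OptA T α σ θ, ∀ q ∈ RVA T α σ θ, σ p < σ q → Ψv p < Ψv q)
    (hT : T.Nonempty) {θ₁ θ₂ : ℝ} (h : PhiA T α σ Ψv θ₁ = PhiA T α σ Ψv θ₂) :
    RVA T α σ θ₁ = RVA T α σ θ₂ := by
  by_cases hex : ∃ p ∈ RVA T α σ θ₁, ∃ q ∈ RVA T α σ θ₂, α p = α q ∧ σ p = σ q
  · obtain ⟨p, hp, q, hq, hpq⟩ := hex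
    exact RVA_eq_of_ptEq hp hq hpq
  · have hne : ∀ p ∈ RVA T α σ θ₁, ∀ q ∈ RVA T α σ θ₂, ¬ (α p = α q ∧ σ p = σ q) :=
      fun p hp q hq hpq => hex ⟨p, hp, q, hq, hpq⟩
    rcases lt_trichotomy θ₁ θ₂ with hlt | heq | hgt
    · exact absurd h (ne_of_lt (PhiA_lt Ψv F3 hT hlt hne))
    · rw [heq]
    · have hne' : ∀ q ∈ RVA T α σ θ₂, ∀ p ∈ RVA T α σ θ₁, ¬ (α q = α p ∧ σ q = σ p) :=
        fun q hq p hp hqp => hne p hp q hq ⟨hqp.1.symm, hqp.2.symm⟩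
      exact absurd h.symm (ne_of_lt (PhiA_lt Ψv F3 hT hgt hne'))

/-- `Φ ≤ B` when `Ψ ≤ B` on `T`. [folklore] -/
theorem PhiA_le (Ψv : ι → ℕ) {B : ℕ} (hB : ∀ p ∈ T, Ψv p ≤ B) (θ : ℝ) : PhiA T α σ Ψv θ ≤ B :=
  Finset.sup_le fun p hp => hB p (mem_OptA.mp (mem_RVA.mp hp).1).1

/-- THE LINE FAMILY: along one pencil of slopes the right vertices take at most `B + 1` values. -/
theorem exists_lineFamily {κ : Type*} [DecidableEq κ] (Ψv : ι → ℕ)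
    (F3 : ∀ θ : ℝ, ∀ p ∈ OptA T α σ θ, ∀ q ∈ RVA T α σ θ, σ p < σ q → Ψv p < Ψv q)
    (hT : T.Nonempty) {B : ℕ} (hB : ∀ p ∈ T, Ψv p ≤ B) (Nf : Finset ι → κ) :
    ∃ 𝒩 : Finset κ, 𝒩.card ≤ B + 1 ∧ (∀ θ : ℝ, Nf (RVA T α σ θ) ∈ 𝒩) ∧
      ∀ N ∈ 𝒩, ∃ θ : ℝ, N = Nf (RVA T α σ θ) := by
  let θof : ℕ → ℝ := fun k => if h : ∃ θ : ℝ, PhiA T α σ Ψv θ = k then Classical.choose h else 0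
  refine ⟨(Finset.range (B + 1)).image fun k => Nf (RVA T α σ (θof k)), ?_, fun θ => ?_, fun N hN => ?_⟩
  · exact Finset.card_image_le.trans (by simp)
  · refine Finset.mem_image.mpr ⟨PhiA T α σ Ψv θ, Finset.mem_range.mpr (Nat.lt_succ_of_le (PhiA_le Ψv hB θ)), ?_⟩
    have hex : ∃ θ' : ℝ, PhiA T α σ Ψv θ' = PhiA T α σ Ψv θ := ⟨θ, rfl⟩
    have hθof : θof (PhiA T α σ Ψv θ) = Classical.choose hex := dif_pos hex
    rw [hθof, RVA_eq_of_PhiA_eq Ψv F3 hT (Classical.choose_spec hex)]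
  · obtain ⟨k, -, rfl⟩ := Finset.mem_image.mp hN
    exact ⟨θof k, rfl⟩

end Envelope

end Summit.ValiantsHypothesis.ValiantsHypothesis.Theorems.NewtonUnitEquations.TwoProducts.TowerRecord

end
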